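import Literature.Probability.LatticeModels.TorusBlockKernelRemainder
import Literature.Probability.LatticeModels.TorusMomentumSumBound
import HarnessLib

/-!
# Pointwise floor for block kernels from long-range order and an infrared bound (`d = 2`)

Sequel of `TorusBlockKernelFloor.lean` / `TorusBlockKernelRemainder.lean`, where for a symmetric
translation-invariant positive-semidefinite kernel `K` on `(ℤ/Mℤ)^d`, `M = b·m`, one has
`K_b(x,y) ≥ b^{2d}Λ/M^{2d} - R_b`, `R_b = M^{-d} Σ_{k ≠ 0} Re κ̂(k)|1̂_B(k)|²` (`κ = K(0,·)`, `1_B` the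
block indicator, `Λ = Σ_{x,y} K`). Here `d = 2` and `Re κ̂(k) ≤ B/√ε(k)` for `k ≠ 0` is assumed
(`ε(k) = Σ_i (1 - cos(2πk_i/M))` = `dispersion (latticeMomentum M k)`; the `T = 0` form `K̂(k) ≲ B/|k|`
of the Kennedy–Lieb–Shastry / Gaussian-domination infrared bound). Then, uniformly in `M ∈ bℕ`,

  `R_b ≤ 18·B·b³`                     (`remainder_le_of_infraredBound`, for any weights `F(k)`),
  `K_b(x,y) ≥ b⁴ Λ/M⁴ - 18 B b³`      (`blockKernel_floor_of_infraredBound`, coarse form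
                                       `coarseKernel_floor_of_infraredBound`),

so Cesàro long-range order `Λ ≥ a M⁴` yields the POSITIVE pointwise floor `K_b ≥ (a/2) b⁴` for every
block size `b ≥ 36 B/a` — a pointwise (block) order anchor from the infrared bound and long-range
order alone, with no correlation (Griffiths/monotonicity) inequality (input (c) of `LevyTransport`,
route `HubbardSuperconductivity/LevyLogBootstrap`). Ingredients: `|1̂_B(k)| ≤ b²`, Plancherel,
`1 - cos(2πk/M) ≥ 8(|k|_M/M)²` (`one_sub_cos_ge_valMinAbs`), the factorised majorant
`ε(k)^{-1/2} ≤ (M/2) g(|k₀|_M) g(|k₁|_M)`, `g(n) = max(1,n)^{-1/2}`, `Σ_{j ≤ J} j^{-1/2} ≤ 2√J`, and the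
split of `k ≠ 0` at `|k|_∞ ≤ m`. Sources: S. Friedli, Y. Velenik (2017) §10.4 (torus Fourier analysis);
J. Fröhlich, B. Simon, T. Spencer (1976) §3 and T. Kennedy, E. H. Lieb, B. S. Shastry (1988) (infrared
bounds). The block estimate is elementary (folklore). No definition is introduced.
-/

noncomputable section

open Finset Complex
open scoped BigOperators ComplexConjugate Real

namespace Literature.Probability.LatticeModels

namespace TorusBlock

section TwoDim

variable {b m M : ℕ} [NeZero M]

/-- `Σ_{j=1}^{J} j^{-1/2} ≤ 2√J`. [folklore] -/
theorem sum_Icc_inv_sqrt_le (J : ℕ) :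
    ∑ j ∈ Finset.Icc 1 J, 1 / Real.sqrt (j : ℝ) ≤ 2 * Real.sqrt (J : ℝ) := by
  induction J with
  | zero => simp
  | succ J ih =>
      rw [Finset.sum_Icc_succ_top (by omega), Nat.cast_succ]
      have hJ : (0 : ℝ) ≤ J := by positivity
      have hs0 : 0 ≤ Real.sqrt (J : ℝ) := Real.sqrt_nonneg _
      have hs1 : 0 < Real.sqrt ((J : ℝ) + 1) := Real.sqrt_pos.2 (by positivity)
      have hsq0 : Real.sqrt (J : ℝ) ^ 2 = J := Real.sq_sqrt hJ
      have hsq1 : Real.sqrt ((J : ℝ) + 1) ^ 2 = J + 1 := Real.sq_sqrt (by positivity)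
      -- `1/√(J+1) ≤ 2(√(J+1) - √J)`
      have hstep : 1 / Real.sqrt ((J : ℝ) + 1) ≤ 2 * (Real.sqrt ((J : ℝ) + 1) - Real.sqrt (J : ℝ)) := by
        rw [div_le_iff₀ hs1]
        nlinarith [mul_nonneg hs0 hs1.le, sq_nonneg (Real.sqrt ((J : ℝ) + 1) - Real.sqrt (J : ℝ))]
      linarith

/-- The Brillouin-zone lower bound per coordinate: `8(|k_i|_M/M)² ≤ ε(k)` for the nearest-neighbour
dispersion `ε(k) = Σ_i (1 - cos(2πk_i/M))` on `(ℤ/Mℤ)²`. [folklore] -/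
theorem eight_mul_sq_le_dispersion (k : TorusSite 2 M) (i : Fin 2) :
    8 * (((k i).valMinAbs.natAbs : ℝ) / M) ^ 2 ≤ dispersion (latticeMomentum M k) := by
  have h0 := one_sub_cos_ge_valMinAbs M (k 0)
  have h1 := one_sub_cos_ge_valMinAbs M (k 1)
  have c0 : 0 ≤ 1 - Real.cos (2 * π * ((k 0).val : ℝ) / M) := sub_nonneg.2 (Real.cos_le_one _)
  have c1 : 0 ≤ 1 - Real.cos (2 * π * ((k 1).val : ℝ) / M) := sub_nonneg.2 (Real.cos_le_one _)
  simp only [dispersion, latticeMomentum, Fin.sum_univ_two]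
  fin_cases i
  · simp only [Fin.zero_eta]
    linarith
  · simp only [Fin.mk_one]
    linarith

/-- **Factorised majorant for `ε(k)^{-1/2}`** on `(ℤ/Mℤ)²`: for `k ≠ 0`,
`1/√ε(k) ≤ (M/2)·g(|k₀|)·g(|k₁|)` with `g(n) = (max(1,n))^{-1/2}` (since
`ε(k) ≥ 4 max(1,|k₀|) max(1,|k₁|)/M²`). [folklore] -/
theorem inv_sqrt_dispersion_le (k : TorusSite 2 M) (hk : k ≠ 0) :
    1 / Real.sqrt (dispersion (latticeMomentum M k)) ≤
      (M : ℝ) / 2 * (1 / Real.sqrt (max 1 ((k 0).valMinAbs.natAbs : ℝ))) *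
        (1 / Real.sqrt (max 1 ((k 1).valMinAbs.natAbs : ℝ))) := by
  have hM : (0 : ℝ) < M := by exact_mod_cast Nat.pos_of_ne_zero (NeZero.ne M)
  set E : ℝ := dispersion (latticeMomentum M k) with hE
  set x : ℕ := (k 0).valMinAbs.natAbs with hx
  set y : ℕ := (k 1).valMinAbs.natAbs with hy
  have h0 : 8 * ((x : ℝ) / M) ^ 2 ≤ E := eight_mul_sq_le_dispersion k 0
  have h1 : 8 * ((y : ℝ) / M) ^ 2 ≤ E := eight_mul_sq_le_dispersion k 1
  have hxy : ¬ (x = 0 ∧ y = 0) := by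
    rintro ⟨hx0, hy0⟩
    apply hk
    funext i
    fin_cases i
    · simpa [hx, Int.natAbs_eq_zero, ZMod.valMinAbs_eq_zero] using hx0
    · simpa [hy, Int.natAbs_eq_zero, ZMod.valMinAbs_eq_zero] using hy0
  set A : ℝ := max 1 (x : ℝ) with hA
  set B : ℝ := max 1 (y : ℝ) with hB
  have hA1 : 1 ≤ A := le_max_left _ _
  have hB1 : 1 ≤ B := le_max_left _ _
  have hkey : 4 * A * B / (M : ℝ) ^ 2 ≤ E := by
    have h0' : 8 * (x : ℝ) ^ 2 ≤ E * (M : ℝ) ^ 2 := by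
      have := h0
      rwa [div_pow, ← mul_div_assoc, div_le_iff₀ (by positivity)] at this
    have h1' : 8 * (y : ℝ) ^ 2 ≤ E * (M : ℝ) ^ 2 := by
      have := h1
      rwa [div_pow, ← mul_div_assoc, div_le_iff₀ (by positivity)] at this
    rw [div_le_iff₀ (by positivity)]
    rcases Nat.eq_zero_or_pos x with hx0 | hx0 <;> rcases Nat.eq_zero_or_pos y with hy0 | hy0
    · exact absurd ⟨hx0, hy0⟩ hxy
    · have hy1 : (1 : ℝ) ≤ y := by exact_mod_cast hy0
      have hA' : A = 1 := by rw [hA, hx0]; simp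
      have hB' : B = y := by rw [hB]; exact max_eq_right hy1
      rw [hA', hB']
      nlinarith
    · have hx1 : (1 : ℝ) ≤ x := by exact_mod_cast hx0
      have hA' : A = x := by rw [hA]; exact max_eq_right hx1
      have hB' : B = 1 := by rw [hB, hy0]; simp
      rw [hA', hB']
      nlinarith
    · have hx1 : (1 : ℝ) ≤ x := by exact_mod_cast hx0
      have hy1 : (1 : ℝ) ≤ y := by exact_mod_cast hy0
      have hA' : A = x := by rw [hA]; exact max_eq_right hx1
      have hB' : B = y := by rw [hB]; exact max_eq_right hy1
      rw [hA', hB']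
      nlinarith [sq_nonneg ((x : ℝ) - y)]
  have hlow : 2 * Real.sqrt A * Real.sqrt B / M ≤ Real.sqrt E := by
    have hsq : (2 * Real.sqrt A * Real.sqrt B / M) ^ 2 = 4 * A * B / (M : ℝ) ^ 2 := by
      rw [div_pow, mul_pow, mul_pow, Real.sq_sqrt (by linarith), Real.sq_sqrt (by linarith)]
      norm_num
    rw [← Real.sqrt_sq (show (0 : ℝ) ≤ 2 * Real.sqrt A * Real.sqrt B / M by positivity), hsq]
    exact Real.sqrt_le_sqrt hkey
  have hpos : 0 < 2 * Real.sqrt A * Real.sqrt B / M := by positivity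
  calc 1 / Real.sqrt E ≤ 1 / (2 * Real.sqrt A * Real.sqrt B / M) :=
        one_div_le_one_div_of_le hpos hlow
    _ = (M : ℝ) / 2 * (1 / Real.sqrt A) * (1 / Real.sqrt B) := by
        field_simp

/-- Outside the box `{|k₀| ≤ J, |k₁| ≤ J}`: `1/√ε(k) ≤ M/(2(J+1))`. [folklore] -/
theorem inv_sqrt_dispersion_le_of_lt (k : TorusSite 2 M) (J : ℕ)
    (hk : ¬ ((k 0).valMinAbs.natAbs ≤ J ∧ (k 1).valMinAbs.natAbs ≤ J)) :
    1 / Real.sqrt (dispersion (latticeMomentum M k)) ≤ (M : ℝ) / (2 * ((J : ℝ) + 1)) := by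
  have hM : (0 : ℝ) < M := by exact_mod_cast Nat.pos_of_ne_zero (NeZero.ne M)
  set E : ℝ := dispersion (latticeMomentum M k) with hE
  obtain ⟨i, hi⟩ : ∃ i : Fin 2, J + 1 ≤ (k i).valMinAbs.natAbs := by
    by_contra h
    push Not at h
    exact hk ⟨Nat.lt_succ_iff.1 (h 0), Nat.lt_succ_iff.1 (h 1)⟩
  have h8 : 8 * ((((k i).valMinAbs.natAbs : ℕ) : ℝ) / M) ^ 2 ≤ E := eight_mul_sq_le_dispersion k i
  have hi' : (J : ℝ) + 1 ≤ ((k i).valMinAbs.natAbs : ℝ) := by exact_mod_cast hi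
  have hkey : (2 * ((J : ℝ) + 1) / M) ^ 2 ≤ E := by
    have e1 : (2 * ((J : ℝ) + 1) / M) ^ 2 = 4 * ((J : ℝ) + 1) ^ 2 / (M : ℝ) ^ 2 := by
      rw [div_pow, mul_pow]; norm_num
    have e2 : 8 * ((((k i).valMinAbs.natAbs : ℕ) : ℝ) / M) ^ 2 =
        8 * (((k i).valMinAbs.natAbs : ℕ) : ℝ) ^ 2 / (M : ℝ) ^ 2 := by
      rw [div_pow, mul_div_assoc]
    rw [e2] at h8
    rw [e1]
    refine le_trans ?_ h8
    apply div_le_div_of_nonneg_right _ (by positivity)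
    nlinarith
  have hpos : 0 < 2 * ((J : ℝ) + 1) / M := by positivity
  have hlow : 2 * ((J : ℝ) + 1) / M ≤ Real.sqrt E := by
    rw [← Real.sqrt_sq hpos.le]
    exact Real.sqrt_le_sqrt hkey
  calc 1 / Real.sqrt E ≤ 1 / (2 * ((J : ℝ) + 1) / M) := one_div_le_one_div_of_le hpos hlow
    _ = (M : ℝ) / (2 * ((J : ℝ) + 1)) := by rw [one_div_div]

/-- The folded one-dimensional sum of the majorant: with `g(n) = (max(1,n))^{-1/2}` truncated at
`|a|_M ≤ J`, `Σ_{a ∈ ℤ/M} g(|a|_M)·1[|a|_M ≤ J] ≤ 1 + 4√J`. [folklore] -/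
theorem sum_zmod_truncMajorant_le (J : ℕ) :
    ∑ a : ZMod M, (if a.valMinAbs.natAbs ≤ J then 1 / Real.sqrt (max 1 (a.valMinAbs.natAbs : ℝ)) else 0)
      ≤ 1 + 4 * Real.sqrt (J : ℝ) := by
  classical
  set G : ℕ → ℝ := fun j => if j ≤ J then 1 / Real.sqrt (max 1 (j : ℝ)) else 0 with hG
  have hG0 : ∀ j, 0 ≤ G j := fun j => by
    simp only [hG]; split_ifs <;> positivity
  have h1 : ∑ a : ZMod M, (if a.valMinAbs.natAbs ≤ J then 1 / Real.sqrt (max 1 (a.valMinAbs.natAbs : ℝ))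
      else 0) = ∑ a : ZMod M, G a.valMinAbs.natAbs := rfl
  rw [h1]
  refine (sum_zmod_le_of_valMinAbs M G hG0).trans ?_
  have hG00 : G 0 = 1 := by simp [hG]
  rw [hG00]
  have h2 : ∑ j ∈ Finset.Icc 1 (M / 2), G j ≤ ∑ j ∈ Finset.Icc 1 J, 1 / Real.sqrt (j : ℝ) := by
    rw [show (∑ j ∈ Finset.Icc 1 (M / 2), G j) =
        ∑ j ∈ (Finset.Icc 1 (M / 2)).filter (fun j => j ≤ J), 1 / Real.sqrt (max 1 (j : ℝ)) from by
      rw [Finset.sum_filter]]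
    have hsub : (Finset.Icc 1 (M / 2)).filter (fun j => j ≤ J) ⊆ Finset.Icc 1 J := by
      intro j hj
      simp only [Finset.mem_filter, Finset.mem_Icc] at hj ⊢
      omega
    refine (Finset.sum_le_sum_of_subset_of_nonneg hsub fun j _ _ => by positivity).trans ?_
    refine Finset.sum_le_sum fun j hj => ?_
    have hj1 : (1 : ℝ) ≤ j := by exact_mod_cast (Finset.mem_Icc.1 hj).1
    rw [max_eq_right hj1]
  have h3 := sum_Icc_inv_sqrt_le J
  linarith

/-- The box sum of the product majorant factorises:
`Σ_{k ∈ (ℤ/M)²} f(k₀) f(k₁) = (Σ_a f a)²`. [folklore] -/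
theorem sum_torusSite_two_mul (f : ZMod M → ℝ) :
    ∑ k : TorusSite 2 M, f (k 0) * f (k 1) = (∑ a : ZMod M, f a) ^ 2 := by
  rw [sq, Finset.sum_mul_sum, ← Fintype.sum_prod_type']
  exact Fintype.sum_equiv (finTwoArrowEquiv (ZMod M)) _ _ fun k => rfl

/-- **The incoherent remainder is `O(B b³)`** (`d = 2`). For `M = b·m`, any real weights `F(k)`
obeying the infrared bound `F(k) ≤ B/√ε(k)` for `k ≠ 0` (`B ≥ 0`), and the block indicator `1_B`:
`M^{-2} Σ_{k ≠ 0} F(k) |1̂_B(k)|² ≤ 18 B b³`. (Split `k ≠ 0` at `|k|_∞ ≤ m`: inside, `|1̂_B|² ≤ b⁴`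
and the factorised majorant give `≤ B b⁴ (1 + 4√m)²/(2M) ≤ 17 B b³`; outside,
`1/√ε ≤ M/(2(m+1))` and Plancherel give `≤ B b³/2`.) [folklore] -/
theorem remainder_le_of_infraredBound (hM : M = b * m) (F : TorusSite 2 M → ℝ) (B : ℝ) (hB : 0 ≤ B)
    (hIR : ∀ k : TorusSite 2 M, k ≠ 0 → F k ≤ B / Real.sqrt (dispersion (latticeMomentum M k))) :
    (((M : ℝ) ^ 2)⁻¹) * ∑ k ∈ Finset.univ.erase (0 : TorusSite 2 M), F k *
      ‖torusFourier (fun x : TorusSite 2 M =>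
        ((if ∀ i : Fin 2, (x i).val / b = ((0 : TorusSite 2 M) i).val / b then (1 : ℝ) else 0 : ℝ) : ℂ))
        k‖ ^ 2 ≤ 18 * B * (b : ℝ) ^ 3 := by
  classical
  have hMpos : (0 : ℝ) < M := by exact_mod_cast Nat.pos_of_ne_zero (NeZero.ne M)
  have hb : 0 < b := pos_of_eq_mul hM
  have hm : 0 < m := by
    rcases Nat.eq_zero_or_pos m with h | h
    exacts [absurd (by rw [hM, h, mul_zero]) (NeZero.ne M), h]
  have hmR : (1 : ℝ) ≤ m := by exact_mod_cast hm
  have hMR : (M : ℝ) = b * m := by rw [hM]; push_cast; ring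
  set W : TorusSite 2 M → ℝ := fun k => ‖torusFourier (fun x : TorusSite 2 M =>
      ((if ∀ i : Fin 2, (x i).val / b = ((0 : TorusSite 2 M) i).val / b then (1 : ℝ) else 0 : ℝ) : ℂ))
      k‖ ^ 2 with hW
  set E : TorusSite 2 M → ℝ := fun k => dispersion (latticeMomentum M k) with hE
  set g : ZMod M → ℝ := fun a =>
    if a.valMinAbs.natAbs ≤ m then 1 / Real.sqrt (max 1 (a.valMinAbs.natAbs : ℝ)) else 0 with hg
  have hW0 : ∀ k, 0 ≤ W k := fun k => by positivity
  have hWle : ∀ k, W k ≤ (b : ℝ) ^ 4 := fun k => by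
    have h := pow_le_pow_left₀ (norm_nonneg _) (norm_torusFourier_blockIndicator_le (d := 2) hM k) 2
    calc W k ≤ ((b : ℝ) ^ 2) ^ 2 := h
      _ = (b : ℝ) ^ 4 := by ring
  have hWsum : ∑ k, W k = (M : ℝ) ^ 2 * (b : ℝ) ^ 2 :=
    sum_norm_sq_torusFourier_blockIndicator (d := 2) hM
  have hg0 : ∀ a, 0 ≤ g a := fun a => by
    simp only [hg]; split_ifs <;> positivity
  have step1 : ∑ k ∈ Finset.univ.erase (0 : TorusSite 2 M), F k * W k ≤
      B * ∑ k ∈ Finset.univ.erase (0 : TorusSite 2 M), W k * (1 / Real.sqrt (E k)) := by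
    rw [Finset.mul_sum]
    refine Finset.sum_le_sum fun k hk => ?_
    have hk0 : k ≠ 0 := Finset.ne_of_mem_erase hk
    have := mul_le_mul_of_nonneg_right (hIR k hk0) (hW0 k)
    calc F k * W k ≤ B / Real.sqrt (E k) * W k := this
      _ = B * (W k * (1 / Real.sqrt (E k))) := by ring
  set P : TorusSite 2 M → Prop := fun k => (k 0).valMinAbs.natAbs ≤ m ∧ (k 1).valMinAbs.natAbs ≤ m
    with hP
  have hsplit := Finset.sum_filter_add_sum_filter_not (Finset.univ.erase (0 : TorusSite 2 M)) P
    (fun k => W k * (1 / Real.sqrt (E k)))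
  have hin : ∑ k ∈ (Finset.univ.erase (0 : TorusSite 2 M)).filter P, W k * (1 / Real.sqrt (E k)) ≤
      (b : ℝ) ^ 4 * ((M : ℝ) / 2) * (1 + 4 * Real.sqrt (m : ℝ)) ^ 2 := by
    have hterm : ∀ k ∈ (Finset.univ.erase (0 : TorusSite 2 M)).filter P,
        W k * (1 / Real.sqrt (E k)) ≤ (b : ℝ) ^ 4 * ((M : ℝ) / 2) * (g (k 0) * g (k 1)) := by
      intro k hk
      rw [Finset.mem_filter] at hk
      have hk0 : k ≠ 0 := Finset.ne_of_mem_erase hk.1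
      have hmaj := inv_sqrt_dispersion_le k hk0
      have hg1 : g (k 0) = 1 / Real.sqrt (max 1 ((k 0).valMinAbs.natAbs : ℝ)) := if_pos hk.2.1
      have hg2 : g (k 1) = 1 / Real.sqrt (max 1 ((k 1).valMinAbs.natAbs : ℝ)) := if_pos hk.2.2
      rw [hg1, hg2]
      have hE0 : 0 ≤ 1 / Real.sqrt (E k) := by positivity
      calc W k * (1 / Real.sqrt (E k)) ≤ (b : ℝ) ^ 4 * (1 / Real.sqrt (E k)) :=
            mul_le_mul_of_nonneg_right (hWle k) hE0
        _ ≤ (b : ℝ) ^ 4 * ((M : ℝ) / 2 * (1 / Real.sqrt (max 1 ((k 0).valMinAbs.natAbs : ℝ))) *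
              (1 / Real.sqrt (max 1 ((k 1).valMinAbs.natAbs : ℝ)))) :=
            mul_le_mul_of_nonneg_left hmaj (by positivity)
        _ = _ := by ring
    refine (Finset.sum_le_sum hterm).trans ?_
    rw [← Finset.mul_sum]
    refine mul_le_mul_of_nonneg_left ?_ (by positivity)
    calc ∑ k ∈ (Finset.univ.erase (0 : TorusSite 2 M)).filter P, g (k 0) * g (k 1)
        ≤ ∑ k : TorusSite 2 M, g (k 0) * g (k 1) :=
          Finset.sum_le_sum_of_subset_of_nonneg (Finset.subset_univ _)
            fun k _ _ => mul_nonneg (hg0 _) (hg0 _)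
      _ = (∑ a : ZMod M, g a) ^ 2 := sum_torusSite_two_mul g
      _ ≤ (1 + 4 * Real.sqrt (m : ℝ)) ^ 2 := by
          have h1 : ∑ a : ZMod M, g a ≤ 1 + 4 * Real.sqrt (m : ℝ) := sum_zmod_truncMajorant_le m
          have h0 : 0 ≤ ∑ a : ZMod M, g a := Finset.sum_nonneg fun a _ => hg0 a
          exact pow_le_pow_left₀ h0 h1 2
  have hout : ∑ k ∈ (Finset.univ.erase (0 : TorusSite 2 M)).filter (fun k => ¬ P k),
      W k * (1 / Real.sqrt (E k)) ≤ (M : ℝ) / (2 * ((m : ℝ) + 1)) * ((M : ℝ) ^ 2 * (b : ℝ) ^ 2) := by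
    have hterm : ∀ k ∈ (Finset.univ.erase (0 : TorusSite 2 M)).filter (fun k => ¬ P k),
        W k * (1 / Real.sqrt (E k)) ≤ (M : ℝ) / (2 * ((m : ℝ) + 1)) * W k := by
      intro k hk
      rw [Finset.mem_filter] at hk
      have h := inv_sqrt_dispersion_le_of_lt k m hk.2
      calc W k * (1 / Real.sqrt (E k)) ≤ W k * ((M : ℝ) / (2 * ((m : ℝ) + 1))) :=
            mul_le_mul_of_nonneg_left h (hW0 k)
        _ = _ := by ring
    refine (Finset.sum_le_sum hterm).trans ?_
    rw [← Finset.mul_sum, ← hWsum]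
    refine mul_le_mul_of_nonneg_left ?_ (by positivity)
    exact Finset.sum_le_sum_of_subset_of_nonneg (Finset.subset_univ _) fun k _ _ => hW0 k
  have htot : ∑ k ∈ Finset.univ.erase (0 : TorusSite 2 M), W k * (1 / Real.sqrt (E k)) ≤
      (b : ℝ) ^ 4 * ((M : ℝ) / 2) * (1 + 4 * Real.sqrt (m : ℝ)) ^ 2 +
        (M : ℝ) / (2 * ((m : ℝ) + 1)) * ((M : ℝ) ^ 2 * (b : ℝ) ^ 2) := by
    rw [← hsplit]
    exact add_le_add hin hout
  have hsq : (1 + 4 * Real.sqrt (m : ℝ)) ^ 2 ≤ 2 + 32 * (m : ℝ) := by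
    have hs : Real.sqrt (m : ℝ) ^ 2 = m := Real.sq_sqrt (by positivity)
    nlinarith [sq_nonneg (1 - 4 * Real.sqrt (m : ℝ)), Real.sqrt_nonneg (m : ℝ)]
  have hA : (((M : ℝ) ^ 2)⁻¹) * ((b : ℝ) ^ 4 * ((M : ℝ) / 2) * (1 + 4 * Real.sqrt (m : ℝ)) ^ 2) ≤
      17 * (b : ℝ) ^ 3 := by
    calc (((M : ℝ) ^ 2)⁻¹) * ((b : ℝ) ^ 4 * ((M : ℝ) / 2) * (1 + 4 * Real.sqrt (m : ℝ)) ^ 2)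
        ≤ (((M : ℝ) ^ 2)⁻¹) * ((b : ℝ) ^ 4 * ((M : ℝ) / 2) * (2 + 32 * (m : ℝ))) := by
          refine mul_le_mul_of_nonneg_left ?_ (by positivity)
          exact mul_le_mul_of_nonneg_left hsq (by positivity)
      _ = (b : ℝ) ^ 3 / m + 16 * (b : ℝ) ^ 3 := by
          rw [hMR]; field_simp; ring
      _ ≤ (b : ℝ) ^ 3 + 16 * (b : ℝ) ^ 3 := by
          have : (b : ℝ) ^ 3 / m ≤ (b : ℝ) ^ 3 := div_le_self (by positivity) hmR
          linarith
      _ = 17 * (b : ℝ) ^ 3 := by ring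
  have hB' : (((M : ℝ) ^ 2)⁻¹) * ((M : ℝ) / (2 * ((m : ℝ) + 1)) * ((M : ℝ) ^ 2 * (b : ℝ) ^ 2)) ≤
      (b : ℝ) ^ 3 := by
    calc (((M : ℝ) ^ 2)⁻¹) * ((M : ℝ) / (2 * ((m : ℝ) + 1)) * ((M : ℝ) ^ 2 * (b : ℝ) ^ 2))
        = (b : ℝ) ^ 3 * ((m : ℝ) / (2 * ((m : ℝ) + 1))) := by
          rw [hMR]; field_simp
      _ ≤ (b : ℝ) ^ 3 * 1 := by
          refine mul_le_mul_of_nonneg_left ?_ (by positivity)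
          rw [div_le_one (by positivity)]
          linarith
      _ = (b : ℝ) ^ 3 := mul_one _
  calc (((M : ℝ) ^ 2)⁻¹) * ∑ k ∈ Finset.univ.erase (0 : TorusSite 2 M), F k * W k
      ≤ (((M : ℝ) ^ 2)⁻¹) * (B * ∑ k ∈ Finset.univ.erase (0 : TorusSite 2 M),
          W k * (1 / Real.sqrt (E k))) := mul_le_mul_of_nonneg_left step1 (by positivity)
    _ ≤ (((M : ℝ) ^ 2)⁻¹) * (B * ((b : ℝ) ^ 4 * ((M : ℝ) / 2) * (1 + 4 * Real.sqrt (m : ℝ)) ^ 2 +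
          (M : ℝ) / (2 * ((m : ℝ) + 1)) * ((M : ℝ) ^ 2 * (b : ℝ) ^ 2))) :=
        mul_le_mul_of_nonneg_left (mul_le_mul_of_nonneg_left htot hB) (by positivity)
    _ = B * ((((M : ℝ) ^ 2)⁻¹) * ((b : ℝ) ^ 4 * ((M : ℝ) / 2) * (1 + 4 * Real.sqrt (m : ℝ)) ^ 2) +
          (((M : ℝ) ^ 2)⁻¹) * ((M : ℝ) / (2 * ((m : ℝ) + 1)) * ((M : ℝ) ^ 2 * (b : ℝ) ^ 2))) := by
        ring
    _ ≤ B * (17 * (b : ℝ) ^ 3 + (b : ℝ) ^ 3) :=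
        mul_le_mul_of_nonneg_left (add_le_add hA hB') hB
    _ = 18 * B * (b : ℝ) ^ 3 := by ring

/-- **Pointwise floor for block kernels from Cesàro long-range order and an infrared bound**
(`d = 2`). For `M = b·m` and a symmetric, translation-invariant kernel `K` on `(ℤ/Mℤ)²` with
nonnegative quadratic form whose Fourier transform obeys the infrared bound
`Re κ̂(k) ≤ B/√ε(k)` (`k ≠ 0`, `κ = K(0,·)`, `B ≥ 0`): every `b`-block sum satisfies
`K_b(x,y) ≥ b⁴ Λ/M⁴ - 18 B b³` with `Λ = Σ_{x,y} K`. Consequently, Cesàro long-range order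
`Λ ≥ a M⁴` yields the uniform positive floor `K_b(x,y) ≥ (a/2) b⁴` as soon as `b ≥ 36 B/a` — the
"pointwise planar-order anchor" for block transverse kernels, with no correlation inequality.
[folklore] -/
theorem blockKernel_floor_of_infraredBound [NeZero m] (hM : M = b * m)
    (K : TorusSite 2 M → TorusSite 2 M → ℝ)
    (hT : ∀ v x y : TorusSite 2 M, K (x + v) (y + v) = K x y) (hS : ∀ x y : TorusSite 2 M, K x y = K y x)
    (hP : ∀ c : TorusSite 2 M → ℝ, 0 ≤ ∑ x, ∑ y, c x * c y * K x y) (B : ℝ) (hB : 0 ≤ B)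
    (hIR : ∀ k : TorusSite 2 M, k ≠ 0 →
      (torusFourier (fun z => (K 0 z : ℂ)) k).re ≤ B / Real.sqrt (dispersion (latticeMomentum M k)))
    (x y : TorusSite 2 M) :
    (b : ℝ) ^ 4 * (∑ x' : TorusSite 2 M, ∑ y' : TorusSite 2 M, K x' y') / (M : ℝ) ^ 4 -
        18 * B * (b : ℝ) ^ 3 ≤
      ∑ x' : TorusSite 2 M, ∑ y' : TorusSite 2 M,
        if (∀ i : Fin 2, (x' i).val / b = (x i).val / b) ∧ (∀ i : Fin 2, (y' i).val / b = (y i).val / b)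
        then K x' y' else 0 := by
  have h1 := blockKernel_floor_remainder (d := 2) hM K hT hS hP x y
  have h2 := remainder_le_of_infraredBound hM (fun k => (torusFourier (fun z => (K 0 z : ℂ)) k).re)
    B hB hIR
  have h3 : ((b : ℝ) ^ 2) ^ 2 * (∑ x' : TorusSite 2 M, ∑ y' : TorusSite 2 M, K x' y') /
      ((M : ℝ) ^ 2) ^ 2 = (b : ℝ) ^ 4 * (∑ x' : TorusSite 2 M, ∑ y' : TorusSite 2 M, K x' y') /
      (M : ℝ) ^ 4 := by ring
  rw [h3] at h1
  linarith

/-- Coarse form of `blockKernel_floor_of_infraredBound`: for every coarse site `X ∈ (ℤ/mℤ)²`,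
`k_b(X) ≥ b⁴ Λ/M⁴ - 18 B b³` (coarse kernel of `TorusBlockKernels.lean`). [folklore] -/
theorem coarseKernel_floor_of_infraredBound [NeZero m] (hM : M = b * m)
    (K : TorusSite 2 M → TorusSite 2 M → ℝ)
    (hT : ∀ v x y : TorusSite 2 M, K (x + v) (y + v) = K x y) (hS : ∀ x y : TorusSite 2 M, K x y = K y x)
    (hP : ∀ c : TorusSite 2 M → ℝ, 0 ≤ ∑ x, ∑ y, c x * c y * K x y) (B : ℝ) (hB : 0 ≤ B)
    (hIR : ∀ k : TorusSite 2 M, k ≠ 0 →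
      (torusFourier (fun z => (K 0 z : ℂ)) k).re ≤ B / Real.sqrt (dispersion (latticeMomentum M k)))
    (X : TorusSite 2 m) :
    (b : ℝ) ^ 4 * (∑ x' : TorusSite 2 M, ∑ y' : TorusSite 2 M, K x' y') / (M : ℝ) ^ 4 -
        18 * B * (b : ℝ) ^ 3 ≤
      ∑ x' : TorusSite 2 M, ∑ y' : TorusSite 2 M,
        if (∀ i : Fin 2, (x' i).val / b = (X i).val) ∧ (∀ i : Fin 2, (y' i).val / b = 0)
        then K x' y' else 0 := by
  classical
  set s : TorusSite 2 M := fun j => ((b * (X j).val : ℕ) : ZMod M) with hs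
  have key := blockKernel_floor_of_infraredBound hM K hT hS hP B hB hIR s 0
  rw [blockKernel_zero_eq_coarse hM K hT s] at key
  have hβs : (fun i : Fin 2 => (((s i).val / b : ℕ) : ZMod m)) = X := coarse_lift hM X
  have h1 : ∀ i : Fin 2, ((((s i).val / b : ℕ) : ZMod m)).val = (X i).val := fun i => by
    rw [congrFun hβs i]
  simp only [h1] at key
  exact key

end TwoDim

end TorusBlock

end Literature.Probability.LatticeModels

end
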